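import Summits.Ventures.PercRepro.S2SixteenSixScaled
import Summits.Ventures.PercRepro.S2CellsP16A
import Summits.Ventures.PercRepro.S2CobasisCoreSixT
import Summits.Ventures.PercRepro.S2SharpCoreXMidCTQ
import Summits.Ventures.PercRepro.S2MidFlatsTenD

/-!
# PercRepro — S2: THE CELLS `(16, 6)` AND `(16, 10)` OF THE `q = 5` WINDOW — THE KIT'S CORES AT `P = 16` (p7, gen 10; sub-claim S2; the `p = 16` row)

The two cells of the rung the nested dichotomy does not reach, closed by the kit's own cores at `P = 16`:
* `(16, 6)` on the cobasis-T core (S2CobasisCoreSixT) with the COLOOP-FREE caps `10 / 34 / 151` (the kit's 0.988; slack `55/1024`,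
  S2CellsP16A) — `c025_sixteen_six_cf`; a coloop `e` goes through the scaled `(15, 6)` / twice-scaled `(14, 6)` cells of
  S2SixteenSixScaled (the nested dichotomy) as at the kit's `(17, 8)`: **`c025_core_five_sixteen_six`**;
* `(16, 10)` on the quart XMid core (S2SharpCoreXMidCTQ) with `N_mid = 1716·⌊(26 − 8)/2⌋ = 15444` (S2MidFlatsTenD) and the standard
  caps `20 / 188 / 1518` (the kit's 0.922; slack `190/1024`): **`c025_core_five_sixteen_ten`**.
Axioms: standard.
-/

open scoped Matroid

namespace PercRepro

namespace ThmN

open Set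

variable {α : Type}

/-- **The cell `(16, 6)` on a coloop-free core**: the cobasis-T core with `s₃ ≤ 10`, `s₄ ≤ 34`, `s₅ ≤ 151`. -/
theorem c025_sixteen_six_cf (M : Matroid α) [M.Finite]
    (hR : M.eRank = ((16 : ℕ) : ℕ∞)) (hn : M.E.ncard = 16 + 6)
    (hfree : ∀ e ∈ M.E, ∃ A ⊆ M.E \ {e}, e ∉ M.closure A ∧ e ∉ M.closure ((M.E \ {e}) \ A))
    (hK : ∀ e, ¬ M.IsColoop e) : RLS M 16 5 := by
  have hd : M.E.encard = M.eRank + ((6 : ℕ) : ℕ∞) := by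
    rw [hR, ← M.ground_finite.cast_ncard_eq, hn]
    push_cast
    ring
  have hs3 := TriangleCap.core_ncard_triangles_le_cq3 M hfree hd
  rw [show TriangleCap.cq3 6 = 10 by decide] at hs3
  have hcol : M.coloops = ∅ := S2.coloops_eq_empty_of_forall_not M hK
  have hm : 22 ≤ (M.E \ M.coloops).ncard := by
    rw [hcol, Set.sdiff_empty, hn]
  have hd' : M.E.encard = M.eRank + (((5 : ℕ) : ℕ∞) + 1) := by
    rw [hd]; norm_num
  have h := S1.ncard_fourCircuits_sub_div_le_of_nonColoops M hfree hd' (by norm_num) hm (B := 28)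
    (fun M' _ hfree' hd'' => by
      have h := ncard_fourCircuits_le_avgChain16 5 M' hfree' hd''
      rw [show avgChain16 5 = 28 by decide] at h
      exact h)
  have hs4 : {C : Set α | M.IsCircuit C ∧ C.ncard = 4}.ncard ≤ 34 := by
    have := S1.le_mul_div_of_sub_div_le (by norm_num : 4 < 22) h
    omega
  have hs5 := S2.ncard_fiveCircuits_le_of_no_coloop M hfree hd' hK (by omega)
  rw [hn] at hs5
  have h5 : (16 + 6) * S1.avgChain5b 5 / (16 + 6 - 5) = 151 := by
    rw [show S1.avgChain5b 5 = 117 by decide]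
  rw [h5] at hs5
  exact c025_core_five_cobasis_six_cell_t M 16 (by norm_num) hR hn hfree 10 34 151 hs3 hs4 hs5
    ⟨55, by norm_num, S2.cellP16C6_poly, S2.cellP16C6_tail⟩

/-- **THE CELL `(16, 6)` OF THE `q = 5` WINDOW**: `RLS M 16 5` for every finite `e`-free matroid of rank `16` on `22` points
(no coloop: the cobasis-T cell; a coloop `e`: `M ＼ {e}` coloop-free — the scaled `(15, 6)` — or with a second coloop — the
twice-scaled `(14, 6)` — lifted by the kit's coloop step). -/
theorem c025_core_five_sixteen_six (M : Matroid α) [M.Finite]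
    (hR : M.eRank = ((16 : ℕ) : ℕ∞)) (hn : M.E.ncard = 16 + 6)
    (hfree : ∀ e ∈ M.E, ∃ A ⊆ M.E \ {e}, e ∉ M.closure A ∧ e ∉ M.closure ((M.E \ {e}) \ A)) : RLS M 16 5 := by
  classical
  by_cases hK : ∃ e, M.IsColoop e
  · obtain ⟨e, he⟩ := hK
    obtain ⟨hn', hR', hfree', -⟩ := delete_core_data M he (p := 15) (d := 6) (by rw [hR]) hn hfree
    set N := M ＼ {e} with hN
    have key : phiK 16 5 / 2 * (Matroid.topCount N 15 5 : ℚ) ≤ (Matroid.midCount N 15 5 : ℚ) := by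
      by_cases hK' : ∃ f, N.IsColoop f
      · obtain ⟨f, hf⟩ := hK'
        obtain ⟨hn'', hR'', hfree'', -⟩ := delete_core_data N hf (p := 14) (d := 6) (by rw [hR']) hn' hfree'
        have key' := c025_fourteen_six_std (N ＼ {f}) hR'' hn'' hfree''
        have key'' : phiK 16 5 / 2 / 2 * (Matroid.topCount (N ＼ {f}) 14 (4 + 1) : ℚ) ≤
            (Matroid.midCount (N ＼ {f}) 14 (4 + 1) : ℚ) := by
          rw [div_div, show (2 : ℚ) * 2 = 4 by norm_num]
          exact key'
        exact weighted_of_isColoop_scaled N hf (by norm_num : 4 + 1 < 14) (by rw [hR']) (phiK 16 5 / 2) key''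
      · push Not at hK'
        exact c025_fifteen_six_cf N hR' hn' hfree' hK'
    rw [RLS_iff]
    exact weighted_of_isColoop_scaled M he (by norm_num : 4 + 1 < 15) (by rw [hR]) (phiK 16 5) key
  · push Not at hK
    exact c025_sixteen_six_cf M hR hn hfree hK

/-- **THE CELL `(16, 10)` OF THE `q = 5` WINDOW**: the quart XMid core, `N_mid = 1716·⌊(26 − 8)/2⌋ = 15444` (S2MidFlatsTenD at
`|E| = 26`), `s₃ ≤ 20`, `s₄ ≤ 188`, `s₅ ≤ 1518`; slack `190/1024`. -/
theorem c025_core_five_sixteen_ten (M : Matroid α) [M.Finite]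
    (hR : M.eRank = ((16 : ℕ) : ℕ∞)) (hn : M.E.ncard = 16 + 10)
    (hfree : ∀ e ∈ M.E, ∃ A ⊆ M.E \ {e}, e ∉ M.closure A ∧ e ∉ M.closure ((M.E \ {e}) \ A)) :
    RLS M 16 5 := by
  have hL0 : ∀ e ∈ M.E, ¬ M.IsLoop e := not_isLoop_of_free M hfree
  have hd : M.E.encard = M.eRank + 10 := by
    rw [hR, ← M.ground_finite.cast_ncard_eq, hn]
    push_cast
    ring
  have hs : ∀ e ∈ M.E, ∀ f ∈ M.E, e ≠ f → M.eRk {e, f} = 2 := by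
    intro e he f hf hef
    have h2 : (2 : ℕ∞) ≤ M.eRk {e, f} :=
      two_le_eRk_of_two_le_ncard_of_free M hfree (pair_subset he hf) (by rw [ncard_pair hef])
    have h3 : M.eRk {e, f} ≤ 2 := by
      have := M.eRk_le_encard {e, f}
      rwa [encard_pair hef] at this
    exact le_antisymm h3 h2
  have hC1 : ∀ L ⊆ M.E, M.eRk L = 2 → L.ncard ≤ 3 :=
    fun L hL hr => ncard_le_three_of_eRk_two M hs hfree hL hr
  have hflat' : ∀ X ⊆ M.E, M.eRk X ≤ ((5 - 1 : ℕ) : ℕ∞) → X.ncard ≤ 10 := fun X hX hr =>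
    ncard_le_ten_of_eRk_le_four_of_free M hfree hX (by simpa using hr)
  have hC2 : ∀ P ⊆ M.E, M.eRk P ≤ 3 → P.ncard ≤ 6 :=
    fun P hP hr => ncard_le_six_of_eRk_le_three_of_free M hfree hP hr
  have hC0 : ∀ X ⊆ M.E, M.eRk X ≤ 1 → X.ncard ≤ 1 := fun X hX hr => by
    have := ncard_add_one_le_two_pow_of_eRk_le M hL0 hfree 1 X hX hr
    omega
  have hmid := S2.card_spanMid_le_ten_sharp hC1 hflat' hC2 hC0 hd (by omega)
  have hmid' : (S2.spanMid M 5 (min 10 (4 + 10)) ((10 + 6) / 2 + 1)).card ≤ 1716 * ((26 - 8) / 2) := by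
    rw [show min 10 (4 + 10) = 10 by norm_num, show (10 + 6) / 2 + 1 = 9 by norm_num]
    calc (S2.spanMid M 5 10 9).card ≤ 1716 * ((M.E.ncard - 8) / 2) := hmid
      _ = 1716 * ((26 - 8) / 2) := by rw [hn]
  have hs3 := TriangleCap.core_ncard_triangles_le_cq3 M hfree hd
  rw [show TriangleCap.cq3 10 = 20 by decide] at hs3
  have hs4 := ncard_fourCircuits_le_avgChain16 10 M hfree hd
  rw [show avgChain16 10 = 188 by decide] at hs4
  have hs5 := S1.ncard_fiveCircuits_le_avgChain5b 10 M hfree hd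
  rw [show S1.avgChain5b 10 = 1518 by decide] at hs5
  have key := c025_core_five_sharp_cell_xmidctq M 16 10 (1716 * ((26 - 8) / 2)) (by norm_num) hR hn hfree 20 188 1518
    hs3 hs4 hs5 hmid'
  exact key ⟨190, by norm_num, S2.cellP16XM10_poly, S2.cellP16XM10_tail⟩

end ThmN

end PercRepro
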